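import Summits.AnomalousDissipation.AnomalousDissipation.Theorems.BaireTransferDenseLoudDesignerForcesHomoclinicLine
import Summits.AnomalousDissipation.AnomalousDissipation.Theorems.BaireTransferDenseLoudDesignerForcesStubTrainBudget
import HarnessLib.Audit

/-!
# Line `homoclinic-excursion-trains` — skeleton v3 for crux `BaireTransfer.DenseLoudDesignerForces`
(item stmt-AnomalousDissipation-1143, route route-AnomalousDissipation-BaireTransfer; lead prover-line-…-1143-1, 2026-08-16)

STATE (v3, after WAVE 1): `stub_trainBudget` LANDED (p97760) and is imported; `stub_oneLoopTrains` came back `stub-blocked` with a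
CHECKED decomposition (work/stubs/stub_oneLoopTrains.scout.lean, rc 0: the abstract Chow–Lin–Palmer shadowing lemma LANDED as the
Literature named fact `Literature.Dynamics.Hyperbolic.ChowLinPalmerShadowing` (p97402) + three sorried NS_ν-dictionary statements
D1a `SectionPackage.exists_sectionPackage`, D1b–d `SectionPackage.exists_isCLPHyperbolicSet` (needs SteinleinWalther1990, unheld
acq-05264), D2 `SectionPackage.train_of_periodic_shadow`; the composition from them is sorry-free); `stub_denseLoudLoops` is the
residual (lead).  2 sorries left in this file.  The line's VOCABULARY and SORRY-FREE GLUE have LANDED as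
`Theorems/BaireTransferDenseLoudDesignerForcesHomoclinicLine.lean` (p95936; namespace
`…Theorems.DenseLoudDesignerForces.Homoclinic`: `LinNSAround`, `LinNSAroundC`, `flowDir`, `IsHyperbolicOrbit`, `h1DistSq`,
`IsHomoclinicTo`, `IsTransverse`, `IsHomoclinicLoop`, `IsTrain`, `dwellSet`, `trainDwell`, `loopSet`; glue `dwellSet_bddBelow`,
`fatness_nonneg`, `exists_short_train_of`, `loopSet_subset_loudSet_of`, Entry 2 `mem_loopSet_of_loudHyperbolicOrbit`, the
registered sub-goal `homoclinic_line_glue` and the CONDITIONAL composition `Homoclinic.DenseLoudDesignerForces_of`).  This file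
keeps exactly the three REGISTERED STUBS (sorried; `ledger skeleton check` 2026-08-16) and the composition, which is the landed
conditional composition applied to them — so it concludes the crux BY NAME modulo the stubs and nothing else.  As stubs land
(`Theorems/BaireTransferDenseLoudDesignerForcesStub<Name>.lean`, `--supports stmt-AnomalousDissipation-1143`) their `sorry`
here is replaced by an import.

Stubs: `stub_oneLoopTrains` (ENGINE, XL: Smale–Birkhoff / shadowing-with-uniqueness for the NS_ν semiflow near a hyperbolic
transverse homoclinic loop; HaleLin1986 Thm 5.2 + §8, SteinleinWalther1990, ChowLinPalmer1989 = Pilyugin1999 §1.3.4),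
`stub_trainBudget` (BUDGET, M: duty-weighted two-sided period means of a train), `stub_denseLoudLoops` (PHYSICS = H_ex′, the
residual, HARDEST: loud duty-dominated loops dense per level).  Idea card `Ideas/homoclinic-excursion-trains.md`, line card
`Lines/homoclinic-excursion-trains.md` (crux-plan gen 2), v1 of this skeleton = the planner's (same stubs, vocabulary inline).

Disproof obligations (Cruxes/DenseLoudDesignerForces/Disproof.lean v15b + landed Negative/*): §7 convection honoured at
`stub_denseLoudLoops` (loud window of a long excursion must be power-fed: `reynoldsWork_ge`); §9 not band-limited, §10 no free
level, §12 planar-false, §13 Beltrami-false, §17 period floor (train periods are long) — unchanged from v1 (see the line card).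
-/

set_option linter.dupNamespace false

noncomputable section

open scoped BigOperators Topology
open Filter Set Function TopologicalSpace MeasureTheory

namespace Summit.AnomalousDissipation.AnomalousDissipation.Cruxes.DenseLoudDesignerForces.HomoclinicExcursionTrains

open Literature.Analysis.FunctionSpaces Literature.Analysis.FunctionSpaces.Torus
open Literature.Analysis.FluidPDE
open Summit.AnomalousDissipation.AnomalousDissipation.Theses.BaireTransfer
open Summit.AnomalousDissipation.AnomalousDissipation.Theorems.DenseLoudDesignerForces.Negative
open Summit.AnomalousDissipation.AnomalousDissipation.Theorems.DenseLoudDesignerForces.Homoclinic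

/-- The flat unit torus `T³`. -/
local notation "𝕋³" => UnitAddTorus (Fin 3)
/-- Real velocity values. -/
local notation "ℝ³" => EuclideanSpace ℝ (Fin 3)
/-- Complex Fourier coefficients / complexified velocities. -/
local notation "ℂ³" => EuclideanSpace ℂ (Fin 3)

/-! ## The three registered stubs of the line -/

/-- **Stub 1 — ENGINE: one-loop trains exist (Smale–Birkhoff / shadowing for the NS_ν semiflow).**
At `ν > 0`, a hyperbolic–transverse homoclinic loop `(u_P, τ_P, u_Γ)` of NS_ν(F) admits, for every cut length
`ℓ ≥ 0` and every accuracy `δ > 0`, a one-loop train: a periodic classical solution of NS_ν(F) of period `ℓ + d`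
(`d ≥ 0`) that is `δ`-close in `H¹` to `u_Γ(t)` for all `t ∈ [-d/2, ℓ + d/2]`.
Why plausible (proof route, three printed ingredients + one dictionary):
(i) SECTION MODEL — at fixed `ν > 0` the forced NS semiflow on the mean slice of `H¹_σ(T³)` is analytic with
compact, injective time-`t` maps having injective derivative (parabolic smoothing; backward uniqueness); the
first-return map `Φ` of a codimension-one section through `u_P(0)` and the transit map along the excursion are
`C¹` (indeed `C^ω`) with `DΦ` uniformly continuous near the compact set `T := {p₀} ∪ {q_n}` of section points of
`P ∪ Γ` (Henry1981 Ch. 7–8; HaleLin1986 §8: Def. 8.1 hyperbolic periodic trajectory := `σ(DΦ(p₀)) ∩ S¹ = ∅`,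
independent of the section, Thm. 8.3 local stable/unstable manifolds).  DICTIONARY: `IsHyperbolicOrbit` (no
unimodular Floquet–Bloch multiplier in the mean-zero slice except the algebraically simple `1`) ⇔ `p₀` is a
hyperbolic fixed point of `Φ` (compact monodromy ⇒ Riesz–Schauder: Bloch solutions on `ℝ` = eigenvectors;
quotienting the flow direction = passing to the section); `IsTransverse` (Palmer form: the `H¹`-bounded solutions
on `ℝ` of the linearised equation along `Γ` are `ℝ∂ₜu_Γ`) ⇔ `{q_n}` is a TRANSVERSAL homoclinic trajectory of
`Φ` (HaleLin1986 Def. 8.2 "iff transverse on the section"; Palmer1984 Prop. 2.2(ii) + Lemma 4.2, Lin1986: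
transversality ⇔ exponential dichotomy of the variational equation on `ℤ` ⇔ no non-trivial bounded solution).
(ii) HYPERBOLIC SET — a transversal homoclinic trajectory of a hyperbolic fixed point of a `C¹` map in a Banach
space has hyperbolic closure `T` (SteinleinWalther1990, title theorem; Pilyugin1999 Def. 1.14 "Steinlein–Walther
hyperbolic set", which does not even need `DΦ`-invariant unstable spaces; HaleLin1986 Thm. 5.2 = symbolic
dynamics near `T` for `C^k` maps that need not be diffeomorphisms).
(iii) SHADOWING WITH UNIQUENESS near `T` for non-invertible `C¹` maps of Banach spaces (ChowLinPalmer1989 main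
theorem = Pilyugin1999 §1.3.4 (1.89)–(1.90): every `d`-pseudo-orbit in `T` is `ε`-shadowed by a UNIQUE orbit;
Pilyugin1999 Thm. 1.3.1/1.3.4/1.3.5: the sequence-of-maps shadowing lemma with non-invertible linear parts).
Apply (iii) to the ONE-LOOP periodic pseudo-orbit `(q_{-k₋-b}, …, q_{-k₋}, [excursion], q_{k₊}, …, q_{k₊+a})`
repeated periodically (its only jump, at the closing point, is `≲ e^{-λ·min(a,b)τ_P}`): uniqueness makes the
shadowing orbit periodic (shift by one period), i.e. a periodic point of the section dynamics = a periodic STRONG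
solution, smooth by parabolic regularity ⇒ classical.  (iv) PHASE BOOKKEEPING (why the PARAMETRISED `u_Γ` is
shadowed over one full period, planner's check): anchor the train's clock at the departure crossing; along the
finite excursion closeness is continuity of the semiflow; along the `a + b` windings the return times of train and
`Γ` differ by `≤ C₁·ε` per turn, so the accumulated phase drift is `≤ C₁ε(a+b) ≍ ε log(1/ε) → 0`; at the closing
point the two tails of `u_Γ` agree because the train's period `ℓ + d ≈ (a+b+1+k₊+k₋)τ_P + θ₋ − θ₊` satisfies the
phase-matching condition automatically; finally `a − b` is chosen to CENTRE the comparison window `[-d/2, ℓ+d/2]`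
on the loop to within `τ_P` and `a + b` large for accuracy — both free, so every `ℓ ≥ 0`, `δ > 0` is served.
Why it might fail (as a formalisation): none of the fixed-`ν` infrastructure is in the tree (NS_ν semiflow as a
`C¹` compact map, classical ⇄ mild dictionary for the linearised equation, stable/unstable manifolds, shadowing in
Banach space) — size XL; mathematically it is printed theory (foreseen split E1a/E1b/E2 in the line card).  The
degenerate loop `u_Γ = u_P` is harmless (`u_P` itself is a train, `zero_mem_dwellSet`).  NON-STEADY base required
(`IsHomoclinicLoop.nonsteady`): for a steady hyperbolic base a nondegenerate homoclinic orbit is codimension one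
(Shilnikov) and `IsTransverse` would hold at a tame saddle with NO periodic orbits nearby.  Leans on:
`IsClassicalNSSolutionOn`, `LinearizedNSTorus` (`Torus.linConvect`, `Torus.gradientC`, `Torus.IsDivFreeC`),
`TorusClassicalNSUniqueness` (energy methods); UNPROVED in tree, to vendor as named facts: HaleLin1986 Thm. 5.2 +
§8, SteinleinWalther1990 (paywalled, acq-05264), ChowLinPalmer1989 (paywalled, acq-05361), Pilyugin1999 Thm.
1.3.1/1.3.4 and §1.3.4 (held, read), Palmer1984 Prop. 2.2 / Lin1986, Henry1981 (acq-04093).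
[cite: HaleLin1986, Thm. 5.2 and §8 (Def. 8.1–8.2, Thm. 8.3)] [cite: Pilyugin1999, Thm. 1.3.1, §1.3.4 (Chow–Lin–Palmer (1.89)–(1.90); Def. 1.14, Thm. 1.3.4)] -/
theorem stub_oneLoopTrains {ν : ℝ} {F : 𝕋³ → ℝ³} {uP : ℝ → 𝕋³ → ℝ³} {τP : ℝ} {uΓ : ℝ → 𝕋³ → ℝ³}
    (hν : 0 < ν) (hloop : IsHomoclinicLoop ν F uP τP uΓ) {ℓ : ℝ} (hℓ : 0 ≤ ℓ) {δ : ℝ} (hδ : 0 < δ) :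
    ∃ d : ℝ, 0 ≤ d ∧ ∃ (u : ℝ → 𝕋³ → ℝ³) (p : ℝ → 𝕋³ → ℝ), IsTrain ν F uΓ ℓ δ d u p := by
  sorry

/-! **Stub 2 — BUDGET `stub_trainBudget`: LANDED** as
`Theorems/BaireTransferDenseLoudDesignerForcesStubTrainBudget.lean` (p97760, wave 1; namespace `…Homoclinic`, imported above):
`(εₓ − 2νδ√Ḡ)·ℓ/(ℓ+d) ≤ meanDissipation ν u ∧ meanEnergy u ≤ 2Ē + 2δ² + 2P̄·d/(ℓ+d)` for every train of a loud excursion. -/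

/-- **Stub 3 — PHYSICS (the sharpened Transfer `H_ex′`; HARDEST): loud, duty-dominated homoclinic loops are
dense per level.**  For every finite stock `S₀` there are `S ⊇ S₀`, an excursion loudness `εₓ > 0`, a window-mean
energy bound `Ē` and a non-empty open `U ⊆ P_S` such that at EVERY level `j` the set `LOOP_j(S, εₓ, Ē)` (`loopSet`:
at some `ν < 1/(j+1)`, `f_c` carries a hyperbolic–transverse homoclinic loop with a loud excursion window of length
`ℓ` and window-mean energy `≤ Ē`, SOME loop-wide fatness/gradient bounds `P̄, Ḡ`, and fatness-weighted closing time
`(1 + P̄)·trainDwell ≤ ℓ` at an affordable accuracy `δ ≤ 1`, `4νδ√Ḡ ≤ εₓ`) is DENSE in `U`.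
WHERE THE CRUX'S ONE RELAXATION ENTERS: here and only here — `(ν, P, Γ, ℓ, P̄, Ḡ, δ)` are chosen after `c` and
`j`, and only DENSITY of such `c` in `U` is asked (never membership of a fixed `c`, never a fixed ball at all
levels, never force-openness or a `ν`-uniform radius).
Why plausible: the documented structure of steadily forced 3-D box flows at and beyond onset — subcritical
transition, edge states, hyperbolic (relative) periodic orbits and homoclinic tangles (VanveenKawahara2011: tangle
of an edge periodic orbit in shear flow; VeenGoto2016: subcritical 3-D Kolmogorov flow; KawaharaUhlmannVanveen2012
§4–5) — with turbulent-transient lifetimes growing super-exponentially in `1/ν` while the closing time grows like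
the inverse slowest Floquet rate times a logarithm (`≲ ν⁻¹log` for a calm or fat base whose slowest stable rate is
viscous, faster under advection-enhanced relaxation) and the fatness like `ν⁻²` at worst — so
`(1 + P̄)·trainDwell ≲ ν⁻³log ≪ ℓ` with enormous room once `ν` is small IF the excursion is a metastable turbulent
episode; deep in the turbulent regime the same clause is met by O(1)-energy bases embedded in the turbulent set
(`P̄ ≍ Ē`, `Γ` = a long generic turbulent segment returning to an embedded UPO — the Smale–Birkhoff form of closing
typical recurrences, cf. the sibling line `ergodic-budget-selection-closing`); hyperbolicity and transversality
are generic where the tangle exists at all, and density (not openness) in `c` is all that is asked, with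
`(ν, P, Γ)` re-chosen per level (the crux's own resource).
Why it might FAIL (named, measurable modes, triage r2-1/r2-2/r2-3): (1b) DWELL BLOW-UP — bases available at
small `ν` are weakly hyperbolic (`λ_slow → 0`) or fat, or the transversality constant `L` degenerates, faster than
`ℓ(ν)` grows, so `(1 + P̄)·trainDwell > ℓ` at every affordable `δ` (the one computed NS tangle, VanveenKawahara2011
at `Re = 400`, has SHORT bursts — r2-2); (1c) NO RETURN — at small `ν` turbulence is an attractor disjoint from
`W^s` of every hyperbolic periodic orbit outside it (sustained, never relaminarising), so loud `Γ` exist only for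
bases INSIDE the turbulent set and the line adds to plain UPO closing only the freedom of a long excursion; and in
all regimes the loudness of the excursion is the zeroth law in transient form (`εₓℓ ≤ ℓ‖f_c‖₂√Ē + P̄/2` by the
window energy balance) — NOT evaded, only moved from exact periodic orbits to ONE finite-window transient plus two
finite hyperbolic objects.  Size: open (the bet).  Leans on: `loopSet` and everything above; Disproof §8
`reynoldsWork_ge` (what the excursion must do), §10 (no free level).  Cheapest falsifier (kit, for the lead):
Galerkin 3-D Kolmogorov flow `|k|∞ ≤ 4` with a small generic trig-poly perturbation of the force, at the
VeenGoto2016 transition `ν`: edge-track to a periodic edge orbit `P`, shoot `W^u(P)`, detect return (`Γ`), measure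
`ℓ`, `P̄` and the one-loop closing time by Newton–Krylov on the train; repeat at `ν/2`, `ν/4` — a FALLING
`ℓ/((1+P̄)·trainDwell)` kills the line for that force family. [cite: VanveenKawahara2011, abstract and §Homoclinic orbit computation (arXiv:1103.1331)] -/
theorem stub_denseLoudLoops :
    ∀ S₀ : Finset (Fin 3 → ℤ), ∃ S : Finset (Fin 3 → ℤ), S₀ ⊆ S ∧
      ∃ (εx Eb : ℝ), 0 < εx ∧
        ∃ U : Set (↥S → ℂ³), IsOpen U ∧ U.Nonempty ∧ ∀ j : ℕ, U ⊆ closure (loopSet S εx Eb j) := by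
  sorry

/-! ## Composition -/

/-- **Composition: the three stubs prove the crux `DenseLoudDesignerForces` (by name)** — the landed conditional
composition `Homoclinic.DenseLoudDesignerForces_of` (p95936) applied to the three registered stubs. -/
theorem DenseLoudDesignerForces_of : DenseLoudDesignerForces :=
  Summit.AnomalousDissipation.AnomalousDissipation.Theorems.DenseLoudDesignerForces.Homoclinic.DenseLoudDesignerForces_of
    (fun _ν _F _uP _τP _uΓ hν hloop _ℓ hℓ _δ hδ => stub_oneLoopTrains hν hloop hℓ hδ)
    (fun _ν _ℓ _δ _d _εx _Eb _Pb _Gb _F _uΓ _u _pΓ _p hν hℓ hd hδ hΓ htrain hwin hwinE hP hG =>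
      stub_trainBudget hν hℓ hd hδ hΓ htrain hwin hwinE hP hG)
    stub_denseLoudLoops

end Summit.AnomalousDissipation.AnomalousDissipation.Cruxes.DenseLoudDesignerForces.HomoclinicExcursionTrains

end
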